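import Mathlib.Geometry.Manifold.ContMDiff.Atlas
import Mathlib.Geometry.Manifold.ContMDiff.NormedSpace
import Mathlib.Analysis.InnerProductSpace.Projection.Reflection
import Literature.Topology.FourManifolds.ClosedBall
import HarnessLib

/-!
# Discharge of `isDouble_sphere`: the sphere `𝕊ⁿ⁺¹` is the double of the closed ball `𝔻ⁿ⁺¹`

Sibling proof file of `Literature/Topology/FourManifolds/ClosedBall.lean`, proving its named fact
`Literature.isDouble_sphere n` (for every `n`): `𝕊ⁿ⁺¹ = 𝔻ⁿ⁺¹ ∪_{id} 𝔻ⁿ⁺¹` in the sense of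
`Literature.Topology.FourManifolds.IsDouble` / `Literature.Topology.FourManifolds.IsClosedGluing` (`Gluing.lean`), i.e. there are two smooth embeddings
`jA, jB : 𝔻ⁿ⁺¹ ↪ 𝕊ⁿ⁺¹` (Mathlib's `Manifold.IsSmoothEmbedding` for the manifold-with-boundary
structure `instChartedSpaceClosedBall`, model `𝓡∂ (n + 1)`, and Mathlib's analytic sphere,
model `𝓡 (n + 1)`) whose images cover `𝕊ⁿ⁺¹` and such that `jA a = jB b` iff `a = b ∈ 𝕊ⁿ`.
This is node (h2) of the decomposition of `Literature.Topology.FourManifolds.cerf_twistedSphere_four`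
(`CerfGammaFourProofs.lean`), and it feeds `Literature.Topology.FourManifolds.isTwistedSphere_refl_sphere`
(`TwistedSpheres.lean`).

## Informal content and proof

The closed hemispheres of `𝕊ⁿ⁺¹` are diffeomorphic to `𝔻ⁿ⁺¹` and meet along the equator
`𝕊ⁿ`, so `𝕊ⁿ⁺¹` is the double of the disc (Hirsch, *Differential Topology* (1976), §8.2,
Example; Bröcker–Jänich, *Introduction to Differential Topology* (1982), §13; Kosinski,
*Differential Manifolds* (1993), VI.5). To make the embeddings smooth *up to the boundary* for
the given smooth structure of `𝔻ⁿ⁺¹` (whose boundary charts use the collar coordinate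
`t = 1 - ‖x‖`) one cannot use the graph `x ↦ (x, √(1 - ‖x‖²))` (its height `√(2t - t²)` is not
smooth in `t` at `t = 0`); we use instead the **inverse stereographic projection**
`hemisphereMap n v : x ↦ σᵥ⁻¹ (2x)`, `σᵥ = stereographic' (n + 1) v` Mathlib's chart of `𝕊ⁿ⁺¹`
from the pole `v`, a rational map smooth on all of `ℝⁿ⁺¹` sending `𝔻ⁿ⁺¹` onto the closed
hemisphere `{y | ⟪y, v⟫ ≤ 0}` (`⟪σᵥ⁻¹ w, v⟫ = (‖w‖² - 4)/(‖w‖² + 4)`, `inner_stereographic'_symm`),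
and its mirror image `sphereReflection v ∘ hemisphereMap n v` under the reflection of `𝕊ⁿ⁺¹` in
the hyperplane `vᗮ` (a diffeomorphism, from Mathlib's `Submodule.reflection`).

*Immersion property.* At `x ∈ 𝔻ⁿ⁺¹` with atlas chart `e` (interior chart, or boundary chart at
`x/‖x‖`), the codomain chart is `σᵥ / 2` followed by a partial diffeomorphism `D` of `ℝⁿ⁺¹`
extending `e` to the ambient space (the translation `w ↦ w + 2e₀`, resp. the ambient **polar
chart** `polarChart p : w ↦ (1 - ‖w‖, σ_{-p}(w/‖w‖))`, which continues the boundary chart across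
the unit sphere); it lies in the maximal atlas of `𝕊ⁿ⁺¹` (`trans_mem_maximalAtlas_of_contDiffOn`)
and in these charts `hemisphereMap n v` reads as the identity `ℍⁿ⁺¹ ∩ e.target → ℝⁿ⁺¹`, i.e.
`ContinuousLinearEquiv.prodUnique ∘ (·, 0)` with complement `Unit`
(`isImmersionAtOfComplement_hemisphereMap_of_charts`).

On the way we fill, in the special case needed, Mathlib's `proof_wanted IsSmoothEmbedding.comp`
for *post*composition with a diffeomorphism (`Manifold.IsSmoothEmbedding.diffeomorph_comp`; the
precomposition version is `Manifold.IsSmoothEmbedding.comp_diffeomorph` in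
`CerfGammaFourProofs.lean`). These are deliberate dot-notation extensions in the `Manifold`
namespace.

## Design

* Everything is proved for all `n` (ball dimension `n + 1 ≥ 1`).
* `isDouble_sphere n` is stated under `[Fact (isSmoothEmbedding_sphereInclusion' n)]`; the proof
  uses only that `(closedBallBoundaryData n).incl = Set.inclusion _` (definitional), so
  `isDouble_sphere_holds` keeps the instance argument (now supplied globally by
  `fact_isSmoothEmbedding_sphereInclusion'` of `ClosedBall.lean`).
* The pole is the concrete `spherePole n = e₀`; all lemmas are stated for an arbitrary pole `v`.

## References

* M. W. Hirsch, *Differential Topology*, GTM 33, Springer (1976), §1.1 (stereographic atlas),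
  §1.4, §8.2 Example (double of the disc).
* T. Bröcker, K. Jänich, *Introduction to Differential Topology*, CUP (1982), §13.
* J. M. Lee, *Introduction to Smooth Manifolds*, 2nd ed., GTM 218 (2013), Ch. 4–5, Problem 1-11.
-/

open scoped Manifold ContDiff Topology InnerProductSpace
open Set Function Metric WithLp

noncomputable section

/-! ### Postcomposing immersions and smooth embeddings with a diffeomorphism (Mathlib gap) -/

namespace Manifold

universe u

variable {E : Type*} {E' : Type u} {F : Type*} [NormedAddCommGroup E] [NormedSpace ℝ E]
  [NormedAddCommGroup E'] [NormedSpace ℝ E'] [NormedAddCommGroup F] [NormedSpace ℝ F]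
  {H : Type*} [TopologicalSpace H] {G : Type*} [TopologicalSpace G]
  {I : ModelWithCorners ℝ E H} {J : ModelWithCorners ℝ E' G}
  {M : Type*} [TopologicalSpace M] [ChartedSpace H M]
  {N : Type*} [TopologicalSpace N] [ChartedSpace G N]
  {N' : Type*} [TopologicalSpace N'] [ChartedSpace G N']
  {n : ℕ∞ω} {f : M → N}

/-- **Postcomposition of an immersion (with chosen complement) with a diffeomorphism.** If `f`
is an immersion at `x` and `Φ : N ≅ N'` is a `C^n` diffeomorphism between manifolds with the same
model, then `Φ ∘ f` is an immersion at `x`: keep the domain chart and the linear normal form and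
transport the codomain chart along `Φ⁻¹`. Special case of the composition of immersions
(Mathlib `proof_wanted IsSmoothEmbedding.comp`); Lee, *Introduction to Smooth Manifolds*
(2013), Ch. 4. Dot-notation extension in the `Manifold` namespace (companion of
`IsImmersionAtOfComplement.comp_diffeomorph` in `CerfGammaFourProofs.lean`). [folklore] -/
theorem IsImmersionAtOfComplement.diffeomorph_comp [IsManifold J n N] [IsManifold J n N']
    {x : M} (h : IsImmersionAtOfComplement F I J n f x) (Φ : N ≃ₘ^n⟮J, J⟯ N') :
    IsImmersionAtOfComplement F I J n (Φ ∘ f) x := by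
  set c : OpenPartialHomeomorph N' G := Φ.symm.toHomeomorph.toOpenPartialHomeomorph ≫ₕ h.codChart
    with hc
  have hcatlas : c ∈ IsManifold.maximalAtlas J n N' := by
    rw [IsManifold.mem_maximalAtlas_iff_contMDiffOn]
    constructor
    · have h1 := contMDiffOn_of_mem_maximalAtlas h.codChart_mem_maximalAtlas
      have : ContMDiffOn J J n (h.codChart ∘ Φ.symm) c.source := by
        refine h1.comp Φ.symm.contMDiff.contMDiffOn ?_
        intro y hy
        simpa [hc] using hy
      exact this.congr fun y _ => by simp [hc]
    · have h1 := contMDiffOn_symm_of_mem_maximalAtlas h.codChart_mem_maximalAtlas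
      have : ContMDiffOn J J n (Φ ∘ h.codChart.symm) c.target := by
        refine Φ.contMDiff.comp_contMDiffOn (h1.mono ?_)
        intro y hy
        simpa [hc] using hy
      exact this.congr fun y _ => by simp [hc]
  refine IsImmersionAtOfComplement.mk_of_charts h.equiv h.domChart c h.mem_domChart_source ?_
    h.domChart_mem_maximalAtlas hcatlas ?_ ?_
  · simpa [hc] using h.mem_codChart_source
  · intro y hy
    simpa [hc] using h.source_subset_preimage_source hy
  · intro y hy
    have := h.writtenInCharts hy
    simp only [Function.comp_apply] at this ⊢
    rw [← this]
    simp [hc, OpenPartialHomeomorph.extend]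

/-- Postcomposition of a global immersion (chosen complement) with a diffeomorphism. [folklore] -/
theorem IsImmersionOfComplement.diffeomorph_comp [IsManifold J n N] [IsManifold J n N']
    (h : IsImmersionOfComplement F I J n f) (Φ : N ≃ₘ^n⟮J, J⟯ N') :
    IsImmersionOfComplement F I J n (Φ ∘ f) := fun x =>
  (h x).diffeomorph_comp Φ

omit [NormedAddCommGroup F] [NormedSpace ℝ F] in
/-- **An immersion followed by a diffeomorphism is an immersion.** Lee (2013), Ch. 4. [folklore] -/
theorem IsImmersion.diffeomorph_comp [IsManifold J n N] [IsManifold J n N']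
    (h : IsImmersion I J n f) (Φ : N ≃ₘ^n⟮J, J⟯ N') : IsImmersion I J n (Φ ∘ f) := by
  obtain ⟨F, _, _, h⟩ := h
  exact ⟨F, inferInstance, inferInstance, h.diffeomorph_comp Φ⟩

omit [NormedAddCommGroup F] [NormedSpace ℝ F] in
/-- **A smooth embedding followed by a diffeomorphism is a smooth embedding** (special case of
Mathlib's `proof_wanted IsSmoothEmbedding.comp`). Lee (2013), Ch. 4–5. [folklore] -/
theorem IsSmoothEmbedding.diffeomorph_comp [IsManifold J n N] [IsManifold J n N']
    (h : IsSmoothEmbedding I J n f) (Φ : N ≃ₘ^n⟮J, J⟯ N') : IsSmoothEmbedding I J n (Φ ∘ f) :=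
  ⟨h.isImmersion.diffeomorph_comp Φ, Φ.toHomeomorph.isEmbedding.comp h.isEmbedding⟩

end Manifold

namespace Literature.Topology.FourManifolds

/-- Local notation: `𝔼 n` is the model Euclidean space `EuclideanSpace ℝ (Fin n)`. -/
local notation "𝔼 " n:arg => EuclideanSpace ℝ (Fin n)

/-- Local notation: `𝕊 n` is the unit sphere in `EuclideanSpace ℝ (Fin (n + 1))`. -/
local notation "𝕊 " n:arg => (Metric.sphere (0 : EuclideanSpace ℝ (Fin (n + 1))) 1)

/-- Local notation: `𝔻 n` is the closed unit ball in `EuclideanSpace ℝ (Fin n)`. -/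
local notation "𝔻 " n:arg => (Metric.closedBall (0 : EuclideanSpace ℝ (Fin n)) 1)

attribute [local instance] fact_finrank_euclideanSpace_succ

variable {n : ℕ}

/-! ### Reflections of the sphere -/

section Reflection

variable {m : ℕ}

/-- The hyperplane reflection `y ↦ y - 2⟪y, v⟫ v` of `ℝᵐ⁺¹` in the orthogonal complement of the
unit vector `v` (Mathlib's `Submodule.reflection (ℝ ∙ v)ᗮ`) restricted to the unit sphere `𝕊ᵐ`,
as a map `𝕊ᵐ → 𝕊ᵐ`. [folklore] -/
def sphereReflectionMap (v : 𝕊 m) : (𝕊 m) → 𝕊 m :=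
  Set.codRestrict (fun y : 𝕊 m => (ℝ ∙ (v : 𝔼 (m + 1)))ᗮ.reflection (y : 𝔼 (m + 1))) _
    fun y => by simp [norm_eq_of_mem_sphere]

/-- The reflection map of the sphere in coordinates (definitional). [folklore] -/
@[simp]
theorem coe_sphereReflectionMap (v y : 𝕊 m) :
    (sphereReflectionMap v y : 𝔼 (m + 1)) = (ℝ ∙ (v : 𝔼 (m + 1)))ᗮ.reflection (y : 𝔼 (m + 1)) :=
  rfl

/-- The reflection map of the sphere is an involution. [folklore] -/
theorem sphereReflectionMap_involutive (v : 𝕊 m) : Involutive (sphereReflectionMap v) := fun y =>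
  Subtype.ext (by simp)

/-- The reflection map of the sphere is smooth (restriction of a linear isometry; Mathlib's
`ContMDiff.codRestrict_sphere`). [folklore] -/
theorem contMDiff_sphereReflectionMap (v : 𝕊 m) :
    ContMDiff (𝓡 m) (𝓡 m) ∞ (sphereReflectionMap v) :=
  ContMDiff.codRestrict_sphere
    (((ℝ ∙ (v : 𝔼 (m + 1)))ᗮ.reflection.toContinuousLinearEquiv.contDiff.contMDiff).comp
      contMDiff_coe_sphere) _

/-- **The reflection of `𝕊ᵐ` in the hyperplane `vᗮ`** as a self-diffeomorphism of the analytic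
manifold `𝕊ᵐ` (an involution exchanging `v` and `-v` and fixing the great sphere `vᗮ ∩ 𝕊ᵐ`).
[folklore] -/
def sphereReflection (v : 𝕊 m) : (𝕊 m) ≃ₘ⟮𝓡 m, 𝓡 m⟯ 𝕊 m where
  toEquiv := (sphereReflectionMap_involutive v).toPerm _
  contMDiff_toFun := contMDiff_sphereReflectionMap v
  contMDiff_invFun := by
    have : ((sphereReflectionMap_involutive v).toPerm _).symm = sphereReflectionMap v := by
      ext1 y
      exact ((sphereReflectionMap_involutive v).toPerm _).symm_apply_eq.2
        ((sphereReflectionMap_involutive v) y).symm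
    rw [this]
    exact contMDiff_sphereReflectionMap v

/-- The reflection diffeomorphism of the sphere in coordinates (definitional). [folklore] -/
@[simp]
theorem coe_sphereReflection (v y : 𝕊 m) :
    ((sphereReflection v y : 𝕊 m) : 𝔼 (m + 1)) =
      (ℝ ∙ (v : 𝔼 (m + 1)))ᗮ.reflection (y : 𝔼 (m + 1)) :=
  rfl

/-- The reflection diffeomorphism is the reflection map (definitional). [folklore] -/
theorem sphereReflection_apply (v y : 𝕊 m) : sphereReflection v y = sphereReflectionMap v y := rfl

/-- The reflection diffeomorphism of the sphere is an involution. [folklore] -/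
theorem sphereReflection_sphereReflection (v y : 𝕊 m) :
    sphereReflection v (sphereReflection v y) = y :=
  sphereReflectionMap_involutive v y

/-- The reflection in `vᗮ` negates the `v`-component: `⟪ρᵥ y, v⟫ = -⟪y, v⟫`. [folklore] -/
theorem inner_reflection_orthogonal_singleton (v y : 𝔼 (m + 1)) :
    ⟪(ℝ ∙ v)ᗮ.reflection y, v⟫_ℝ = -⟪y, v⟫_ℝ := by
  rw [← LinearIsometryEquiv.inner_map_map (ℝ ∙ v)ᗮ.reflection ((ℝ ∙ v)ᗮ.reflection y) v,
    Submodule.reflection_reflection, Submodule.reflection_orthogonalComplement_singleton_eq_neg,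
    inner_neg_right]

/-- The reflection of `𝕊ᵐ` in `vᗮ` negates the `v`-component. [folklore] -/
theorem inner_sphereReflection (v y : 𝕊 m) :
    ⟪((sphereReflection v y : 𝕊 m) : 𝔼 (m + 1)), (v : 𝔼 (m + 1))⟫_ℝ =
      -⟪(y : 𝔼 (m + 1)), (v : 𝔼 (m + 1))⟫_ℝ :=
  inner_reflection_orthogonal_singleton _ _

/-- The reflection in `vᗮ` fixes exactly the points orthogonal to `v`. [folklore] -/
theorem sphereReflection_eq_self_iff (v y : 𝕊 m) :
    sphereReflection v y = y ↔ ⟪(y : 𝔼 (m + 1)), (v : 𝔼 (m + 1))⟫_ℝ = 0 := by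
  rw [← Subtype.coe_inj, coe_sphereReflection, Submodule.reflection_eq_self_iff,
    Submodule.mem_orthogonal_singleton_iff_inner_left]

end Reflection

/-! ### Hemispheres: the inverse stereographic projection on the unit ball -/

section Hemisphere

/-- The `v`-component of a point of `𝕊ⁿ⁺¹` given by inverse stereographic projection from the
pole `v` (Mathlib's chart `stereographic' (n + 1) v`, valued in `ℝⁿ⁺¹` and scaled so that the
equator `vᗮ` corresponds to the sphere of radius `2`): `⟪σᵥ⁻¹ w, v⟫ = (‖w‖² - 4) / (‖w‖² + 4)`.
[folklore] -/
theorem inner_stereographic'_symm (v : 𝕊 (n + 1)) (w : 𝔼 (n + 1)) :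
    ⟪(((stereographic' (n + 1) v).symm w : 𝕊 (n + 1)) : 𝔼 (n + 1 + 1)), (v : 𝔼 (n + 1 + 1))⟫_ℝ =
      (‖w‖ ^ 2 - 4) / (‖w‖ ^ 2 + 4) := by
  rw [stereographic'_symm_apply]
  set U := (OrthonormalBasis.fromOrthogonalSpanSingleton (𝕜 := ℝ) (n + 1)
    (ne_zero_of_mem_unit_sphere v)).repr
  have hU : ‖(U.symm w : 𝔼 (n + 1 + 1))‖ = ‖w‖ := by
    rw [← Submodule.coe_norm, LinearIsometryEquiv.norm_map]
  have horth : ⟪(U.symm w : 𝔼 (n + 1 + 1)), (v : 𝔼 (n + 1 + 1))⟫_ℝ = 0 :=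
    Submodule.mem_orthogonal_singleton_iff_inner_left.1 (U.symm w).2
  have hv : ⟪(v : 𝔼 (n + 1 + 1)), (v : 𝔼 (n + 1 + 1))⟫_ℝ = 1 := by
    simp [norm_eq_of_mem_sphere]
  simp only [hU]
  rw [inner_add_left, inner_smul_left, inner_smul_left, inner_smul_left, inner_smul_left, horth, hv]
  simp only [conj_trivial, mul_zero, zero_add, mul_one]
  rw [div_eq_inv_mul]

variable (n) in
/-- **The closed hemisphere opposite `v`, parametrised by the closed ball**: the map
`𝔻ⁿ⁺¹ → 𝕊ⁿ⁺¹`, `x ↦ σᵥ⁻¹ (2 x)`, where `σᵥ = stereographic' (n + 1) v` is Mathlib's stereographic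
chart of `𝕊ⁿ⁺¹` from the pole `v` (a rational map, so smooth on all of `ℝⁿ⁺¹`; the factor `2`
matches Mathlib's normalisation, under which the equator `vᗮ ∩ 𝕊ⁿ⁺¹` is the image of the unit
sphere `𝕊ⁿ = ∂𝔻ⁿ⁺¹`). Its image is the closed hemisphere `{y | ⟪y, v⟫ ≤ 0}`. Hirsch,
*Differential Topology* (1976), §1.1 (stereographic atlas) and §8.2, Example (the double of the
disc is the sphere). [folklore] -/
def hemisphereMap (v : 𝕊 (n + 1)) (x : 𝔻 (n + 1)) : 𝕊 (n + 1) :=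
  (stereographic' (n + 1) v).symm ((2 : ℝ) • (x : 𝔼 (n + 1)))

/-- Unfolding lemma for `hemisphereMap`. [folklore] -/
theorem hemisphereMap_apply (v : 𝕊 (n + 1)) (x : 𝔻 (n + 1)) :
    hemisphereMap n v x = (stereographic' (n + 1) v).symm ((2 : ℝ) • (x : 𝔼 (n + 1))) := rfl

/-- The hemisphere map is continuous. [folklore] -/
theorem continuous_hemisphereMap (v : 𝕊 (n + 1)) : Continuous (hemisphereMap n v) := by
  have h2 : Continuous (stereographic' (n + 1) v).symm := by
    rw [← continuousOn_univ, ← stereographic'_target v]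
    exact (stereographic' (n + 1) v).continuousOn_symm
  exact h2.comp (continuous_subtype_val.const_smul (2 : ℝ))

/-- The hemisphere map avoids the pole `v` (it takes values in the source `{v}ᶜ` of the
stereographic chart from `v`). [folklore] -/
theorem hemisphereMap_mem_source (v : 𝕊 (n + 1)) (x : 𝔻 (n + 1)) :
    hemisphereMap n v x ∈ (stereographic' (n + 1) v).source :=
  (stereographic' (n + 1) v).map_target (by simp)

/-- The stereographic chart from `v` inverts the hemisphere map: `σᵥ (h x) = 2x`. [folklore] -/
@[simp]
theorem stereographic'_hemisphereMap (v : 𝕊 (n + 1)) (x : 𝔻 (n + 1)) :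
    stereographic' (n + 1) v (hemisphereMap n v x) = (2 : ℝ) • (x : 𝔼 (n + 1)) :=
  (stereographic' (n + 1) v).right_inv (by simp)

/-- The hemisphere map is injective. [folklore] -/
theorem injective_hemisphereMap (v : 𝕊 (n + 1)) : Injective (hemisphereMap n v) := by
  intro x y h
  have := congrArg (stereographic' (n + 1) v) h
  rw [stereographic'_hemisphereMap, stereographic'_hemisphereMap] at this
  exact Subtype.ext (smul_right_injective _ two_ne_zero this)

/-- The hemisphere map is a closed topological embedding (continuous injection from a compact
space). [folklore] -/
theorem isEmbedding_hemisphereMap (v : 𝕊 (n + 1)) : Topology.IsEmbedding (hemisphereMap n v) :=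
  ((continuous_hemisphereMap v).isClosedEmbedding (injective_hemisphereMap v)).isEmbedding

/-- The `v`-component of the hemisphere map: `⟪h x, v⟫ = (‖x‖² - 1) / (‖x‖² + 1)`. [folklore] -/
theorem inner_hemisphereMap (v : 𝕊 (n + 1)) (x : 𝔻 (n + 1)) :
    ⟪((hemisphereMap n v x : 𝕊 (n + 1)) : 𝔼 (n + 1 + 1)), (v : 𝔼 (n + 1 + 1))⟫_ℝ =
      (‖(x : 𝔼 (n + 1))‖ ^ 2 - 1) / (‖(x : 𝔼 (n + 1))‖ ^ 2 + 1) := by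
  rw [hemisphereMap_apply, inner_stereographic'_symm, norm_smul, Real.norm_two, mul_pow]
  have h : (‖(x : 𝔼 (n + 1))‖ ^ 2 + 1) ≠ 0 := by positivity
  field_simp
  ring

/-- The hemisphere map takes values in the closed hemisphere `{y | ⟪y, v⟫ ≤ 0}`. [folklore] -/
theorem inner_hemisphereMap_nonpos (v : 𝕊 (n + 1)) (x : 𝔻 (n + 1)) :
    ⟪((hemisphereMap n v x : 𝕊 (n + 1)) : 𝔼 (n + 1 + 1)), (v : 𝔼 (n + 1 + 1))⟫_ℝ ≤ 0 := by
  rw [inner_hemisphereMap]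
  have h1 : ‖(x : 𝔼 (n + 1))‖ ≤ 1 := mem_closedBall_zero_iff.1 x.2
  have h0 : 0 ≤ ‖(x : 𝔼 (n + 1))‖ := norm_nonneg _
  exact div_nonpos_of_nonpos_of_nonneg (by nlinarith) (by positivity)

/-- The hemisphere map sends exactly the boundary sphere `‖x‖ = 1` to the equator `vᗮ`. [folklore] -/
theorem inner_hemisphereMap_eq_zero_iff (v : 𝕊 (n + 1)) (x : 𝔻 (n + 1)) :
    ⟪((hemisphereMap n v x : 𝕊 (n + 1)) : 𝔼 (n + 1 + 1)), (v : 𝔼 (n + 1 + 1))⟫_ℝ = 0 ↔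
      ‖(x : 𝔼 (n + 1))‖ = 1 := by
  rw [inner_hemisphereMap, div_eq_zero_iff, or_iff_left (by positivity), sub_eq_zero,
    pow_eq_one_iff_of_nonneg (norm_nonneg _) two_ne_zero]

/-- Every point of the closed hemisphere `{y | ⟪y, v⟫ ≤ 0}` is in the image of the hemisphere
map. [folklore] -/
theorem mem_range_hemisphereMap {v y : 𝕊 (n + 1)}
    (hy : ⟪(y : 𝔼 (n + 1 + 1)), (v : 𝔼 (n + 1 + 1))⟫_ℝ ≤ 0) : y ∈ range (hemisphereMap n v) := by
  have hyv : y ∈ (stereographic' (n + 1) v).source := by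
    rw [stereographic'_source, mem_compl_singleton_iff]
    rintro rfl
    have : ⟪(y : 𝔼 (n + 1 + 1)), (y : 𝔼 (n + 1 + 1))⟫_ℝ = 1 := by
      simp [norm_eq_of_mem_sphere]
    linarith
  set w := stereographic' (n + 1) v y with hw
  have hyw : y = (stereographic' (n + 1) v).symm w := ((stereographic' (n + 1) v).left_inv hyv).symm
  have hw2 : ‖w‖ ≤ 2 := by
    rw [hyw, inner_stereographic'_symm] at hy
    have h4 : ‖w‖ ^ 2 - 4 ≤ 0 := by
      by_contra h
      exact absurd hy (not_le.2 (div_pos (by linarith) (by positivity)))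
    nlinarith [norm_nonneg w]
  refine ⟨⟨(2 : ℝ)⁻¹ • w, ?_⟩, ?_⟩
  · rw [mem_closedBall_zero_iff, norm_smul, norm_inv, Real.norm_two]
    linarith
  · rw [hemisphereMap_apply, hyw]
    simp

/-- The image of the hemisphere map is the closed hemisphere opposite `v`. [folklore] -/
theorem range_hemisphereMap (v : 𝕊 (n + 1)) : range (hemisphereMap n v) =
    {y : 𝕊 (n + 1) | ⟪(y : 𝔼 (n + 1 + 1)), (v : 𝔼 (n + 1 + 1))⟫_ℝ ≤ 0} := by
  refine Subset.antisymm ?_ fun y hy => mem_range_hemisphereMap (v := v) (y := y) hy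
  rintro _ ⟨x, rfl⟩
  exact inner_hemisphereMap_nonpos v x

end Hemisphere


/-! ### Charts of a boundaryless manifold modified by a local diffeomorphism of the model -/

/-- If `e` is a chart in the `C^∞` maximal atlas of a manifold `M` modelled on the vector space
`E` itself (`𝓘(ℝ, E)`, no boundary) and `D` is a partial homeomorphism of `E` which is smooth on
its source with inverse smooth on its target, then `e ≫ D` is again in the maximal atlas.
[folklore] -/
theorem trans_mem_maximalAtlas_of_contDiffOn {E M : Type*} [NormedAddCommGroup E]
    [NormedSpace ℝ E] [TopologicalSpace M] [ChartedSpace E M] [IsManifold 𝓘(ℝ, E) ∞ M]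
    {e : OpenPartialHomeomorph M E} (he : e ∈ IsManifold.maximalAtlas 𝓘(ℝ, E) ∞ M)
    (D : OpenPartialHomeomorph E E) (hD : ContDiffOn ℝ ∞ D D.source)
    (hD' : ContDiffOn ℝ ∞ D.symm D.target) : e ≫ₕ D ∈ IsManifold.maximalAtlas 𝓘(ℝ, E) ∞ M := by
  rw [IsManifold.mem_maximalAtlas_iff_contMDiffOn, OpenPartialHomeomorph.coe_trans,
    OpenPartialHomeomorph.coe_trans_symm, OpenPartialHomeomorph.trans_source,
    OpenPartialHomeomorph.trans_target]
  constructor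
  · exact (contMDiffOn_iff_contDiffOn.2 hD).comp
      ((contMDiffOn_of_mem_maximalAtlas he).mono inter_subset_left) fun x hx => hx.2
  · exact (contMDiffOn_symm_of_mem_maximalAtlas he).comp
      ((contMDiffOn_iff_contDiffOn.2 hD').mono inter_subset_left) fun x hx => hx.2

/-! ### The ambient polar chart of `ℝⁿ⁺¹` at a direction `p` -/

/-- **Polar coordinates on `ℝⁿ⁺¹ ∖ {0}` away from the ray through `-p`**: the partial
homeomorphism `w ↦ (1 - ‖w‖, σ (w / ‖w‖))` of `ℝⁿ⁺¹`, `σ = stereographic' n (-p)`, with source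
`{w ≠ 0, w / ‖w‖ ≠ -p}`, target `{z | z 0 < 1}` and inverse `z ↦ (1 - z 0) • σ⁻¹ (z 1, …, z n)`.
It extends the boundary chart `closedBallBoundaryChart p` of `𝔻ⁿ⁺¹` (same formula) across the
unit sphere; used as the ambient half of the codomain charts of the hemisphere embeddings.
Hirsch, *Differential Topology* (1976), §1.4. [folklore] -/
def polarChart (p : 𝕊 n) : OpenPartialHomeomorph (𝔼 (n + 1)) (𝔼 (n + 1)) where
  source := {w | w ≠ 0 ∧ ‖w‖⁻¹ • w ≠ -(p : 𝔼 (n + 1))}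
  target := {z | z 0 < 1}
  toFun w := toLp 2 (Fin.cons (1 - ‖w‖)
      (ofLp (stereographic' n (-p) (radialProjection p w))) : Fin (n + 1) → ℝ)
  invFun z := (1 - z 0) •
      ((stereographic' n (-p)).symm (toLp 2 fun i : Fin n => z i.succ) : 𝔼 (n + 1))
  map_source' w hw := by
    simp only [mem_setOf_eq, Fin.cons_zero, sub_lt_self_iff, norm_pos_iff]
    exact hw.1
  map_target' z hz := by
    simp only [mem_setOf_eq] at hz ⊢
    set s := (stereographic' n (-p)).symm (toLp 2 fun i : Fin n => z i.succ)
    have ht : 0 < 1 - z 0 := by linarith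
    have hs : s ∈ (stereographic' n (-p)).source :=
      (stereographic' n (-p)).map_target (by simp)
    rw [stereographic'_source, mem_compl_singleton_iff] at hs
    refine ⟨smul_ne_zero ht.ne' (ne_zero_of_mem_unit_sphere s), fun h => hs ?_⟩
    rw [norm_smul_coe_sphere ht.le, smul_smul, inv_mul_cancel₀ ht.ne', one_smul] at h
    exact Subtype.ext (by simpa using h)
  left_inv' w hw := by
    obtain ⟨hw0, hwp⟩ := hw
    have h2 : (toLp 2 fun i : Fin n => (toLp 2 (Fin.cons (1 - ‖w‖)
        (ofLp (stereographic' n (-p) (radialProjection p w))) : Fin (n + 1) → ℝ)) i.succ) =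
        stereographic' n (-p) (radialProjection p w) := by
      ext i
      simp only [Fin.cons_succ]
    simp only [Fin.cons_zero, sub_sub_cancel]
    rw [h2, (stereographic' n (-p)).left_inv (radialProjection_mem_source_stereographic' hw0 hwp),
      norm_smul_coe_radialProjection]
  right_inv' z hz := by
    simp only [mem_setOf_eq] at hz
    have ht : 0 < 1 - z 0 := by linarith
    simp only
    rw [norm_smul_coe_sphere ht.le, radialProjection_smul p ht,
      (stereographic' n (-p)).right_inv (by simp), sub_sub_cancel]
    ext i
    refine Fin.cases ?_ (fun j => ?_) i <;> simp
  open_source := by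
    have hc : ContinuousOn (fun w : 𝔼 (n + 1) => ‖w‖⁻¹ • w) {w | w ≠ 0} :=
      (continuous_norm.continuousOn.inv₀ fun w hw => norm_ne_zero_iff.2 hw).smul continuousOn_id
    exact hc.isOpen_inter_preimage isOpen_ne isOpen_ne
  open_target := by
    have : Continuous fun z : 𝔼 (n + 1) => z 0 := by fun_prop
    exact isOpen_Iio.preimage this
  continuousOn_toFun := by
    have hF : Continuous fun q : ℝ × 𝔼 n => toLp 2 (Fin.cons q.1 (ofLp q.2) : Fin (n + 1) → ℝ) :=
      by fun_prop
    have hG : ContinuousOn (fun w : 𝔼 (n + 1) =>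
        (1 - ‖w‖, stereographic' n (-p) (radialProjection p w)))
        {w | w ≠ 0 ∧ ‖w‖⁻¹ • w ≠ -(p : 𝔼 (n + 1))} := by
      refine (continuous_const.sub continuous_norm).continuousOn.prodMk ?_
      refine (stereographic' n (-p)).continuousOn.comp
        ((continuousOn_radialProjection p).mono fun w hw => hw.1) fun w hw => ?_
      exact radialProjection_mem_source_stereographic' hw.1 hw.2
    exact hF.comp_continuousOn hG
  continuousOn_invFun := by
    refine Continuous.continuousOn ?_
    have h0 : Continuous fun z : 𝔼 (n + 1) => z 0 := by fun_prop
    have h1 : Continuous fun z : 𝔼 (n + 1) => (toLp 2 fun i : Fin n => z i.succ : 𝔼 n) := by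
      fun_prop
    have h2 : Continuous (stereographic' n (-p)).symm := by
      rw [← continuousOn_univ, ← stereographic'_target (-p)]
      exact (stereographic' n (-p)).continuousOn_symm
    exact (continuous_const.sub h0).smul (continuous_subtype_val.comp (h2.comp h1))

/-- The source of the polar chart (definitional). [folklore] -/
@[simp]
theorem polarChart_source (p : 𝕊 n) :
    (polarChart p).source = {w | w ≠ 0 ∧ ‖w‖⁻¹ • w ≠ -(p : 𝔼 (n + 1))} := rfl

/-- The target of the polar chart (definitional). [folklore] -/
@[simp]
theorem polarChart_target (p : 𝕊 n) : (polarChart p).target = {z | z 0 < 1} := rfl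

/-- The polar chart in coordinates (definitional). [folklore] -/
theorem polarChart_apply (p : 𝕊 n) (w : 𝔼 (n + 1)) :
    polarChart p w = toLp 2 (Fin.cons (1 - ‖w‖)
      (ofLp (stereographic' n (-p) (radialProjection p w))) : Fin (n + 1) → ℝ) := rfl

/-- The inverse of the polar chart: `z ↦ (1 - z 0) • σ⁻¹ (z 1, …, z n)` (definitional). [folklore] -/
theorem polarChart_symm_apply (p : 𝕊 n) (z : 𝔼 (n + 1)) :
    (polarChart p).symm z = (1 - z 0) •
      ((stereographic' n (-p)).symm (toLp 2 fun i : Fin n => z i.succ) : 𝔼 (n + 1)) := rfl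

/-- The polar chart extends the boundary chart of the closed ball: their inverses agree on the
common target `{z | z 0 < 1}` (indeed for `z 0 ≤ 1`). [folklore] -/
theorem coe_closedBallBoundaryChart_symm_eq_polarChart_symm (p : 𝕊 n)
    {z : EuclideanHalfSpace (n + 1)} (hz : z.val 0 ≤ 1) :
    (((closedBallBoundaryChart p).symm z : 𝔻 (n + 1)) : 𝔼 (n + 1)) = (polarChart p).symm z.val :=
  coe_closedBallBoundaryChart_symm_apply p hz

/-- The polar chart is smooth on its source. [folklore] -/
theorem contDiffOn_polarChart (p : 𝕊 n) : ContDiffOn ℝ ∞ (polarChart p) (polarChart p).source := by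
  have heq : EqOn (polarChart p) (fun y => toLp 2 (Fin.cons (1 - ‖y‖)
      (ofLp ((OrthonormalBasis.fromOrthogonalSpanSingleton (𝕜 := ℝ) n
        (ne_zero_of_mem_unit_sphere (-p))).repr
          (stereoToFun ((-p : 𝕊 n) : 𝔼 (n + 1)) (‖y‖⁻¹ • y)))) : Fin (n + 1) → ℝ))
      (polarChart p).source := by
    intro y hy
    rw [polarChart_apply, stereographic'_eq_repr_stereoToFun, coe_radialProjection_of_ne_zero p hy.1]
  refine ContDiffOn.congr (fun y hy => ContDiffAt.contDiffWithinAt ?_) heq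
  obtain ⟨h0, hq⟩ := hy
  have hnorm : ContDiffAt ℝ ∞ (fun y : 𝔼 (n + 1) => ‖y‖) y := contDiffAt_norm ℝ h0
  refine contDiffAt_piLp' 2 fun i => ?_
  refine Fin.cases ?_ (fun j => ?_) i
  · simp only [Fin.cons_zero]
    exact contDiffAt_const.sub hnorm
  · simp only [Fin.cons_succ]
    refine (contDiffAt_piLp_apply 2).comp _ (contDiffAt_repr_stereoToFun_comp (-p)
      ((hnorm.inv (norm_ne_zero_iff.2 h0)).smul contDiffAt_id) ?_ ?_)
    · rw [norm_smul, norm_inv, norm_norm, inv_mul_cancel₀ (norm_ne_zero_iff.2 h0)]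
    · rwa [coe_neg_sphere]

/-- The inverse of the polar chart is smooth on all of `ℝⁿ⁺¹`. [folklore] -/
theorem contDiff_polarChart_symm (p : 𝕊 n) : ContDiff ℝ ∞ (polarChart p).symm := by
  have h0 : ContDiff ℝ ∞ (fun z : 𝔼 (n + 1) => 1 - z 0) :=
    contDiff_const.sub (contDiff_piLp_apply 2)
  exact h0.smul ((contDiff_coe_stereographic'_symm (-p)).comp contDiff_euclideanSpace_tail)

/-! ### The hemisphere maps are smooth embeddings -/

section Immersion

/-- The halving homothety `w ↦ w / 2` of `ℝⁿ⁺¹` as a partial homeomorphism (undoing the factor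
`2` of `hemisphereMap`). [folklore] -/
def halvingChart (n : ℕ) : OpenPartialHomeomorph (𝔼 (n + 1)) (𝔼 (n + 1)) :=
  (Homeomorph.smulOfNeZero (2⁻¹ : ℝ) (by norm_num)).toOpenPartialHomeomorph

/-- The halving chart is `w ↦ w / 2` (definitional). [folklore] -/
@[simp]
theorem halvingChart_apply (w : 𝔼 (n + 1)) : halvingChart n w = (2⁻¹ : ℝ) • w := rfl

/-- The halving chart is defined everywhere (definitional). [folklore] -/
@[simp]
theorem halvingChart_source : (halvingChart n).source = univ := rfl

/-- The halving chart is onto (definitional). [folklore] -/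
@[simp]
theorem halvingChart_target : (halvingChart n).target = univ := rfl

/-- The inverse of the halving chart is doubling. [folklore] -/
theorem halvingChart_symm_apply (w : 𝔼 (n + 1)) : (halvingChart n).symm w = (2 : ℝ) • w := by
  simp [halvingChart]

/-- The stereographic chart from `v` followed by halving, `y ↦ σᵥ y / 2`, is in the maximal atlas
of `𝕊ⁿ⁺¹`; on the hemisphere opposite `v` it inverts `hemisphereMap n v`. [folklore] -/
theorem stereographic'_trans_halvingChart_mem_maximalAtlas (v : 𝕊 (n + 1)) :
    stereographic' (n + 1) v ≫ₕ halvingChart n ∈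
      IsManifold.maximalAtlas (𝓡 (n + 1)) ∞ (𝕊 (n + 1)) := by
  refine trans_mem_maximalAtlas_of_contDiffOn (IsManifold.subset_maximalAtlas (by exact ⟨v, rfl⟩)) _
    ?_ ?_
  · exact (contDiff_const_smul (2⁻¹ : ℝ)).contDiffOn
  · rw [show ((halvingChart n).symm : 𝔼 (n + 1) → 𝔼 (n + 1)) = fun w => (2 : ℝ) • w from
      funext halvingChart_symm_apply]
    exact (contDiff_const_smul (2 : ℝ)).contDiffOn

/-- `σᵥ / 2` inverts the hemisphere map: `σᵥ (h x) / 2 = x`. [folklore] -/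
@[simp]
theorem stereographic'_trans_halvingChart_hemisphereMap (v : 𝕊 (n + 1)) (x : 𝔻 (n + 1)) :
    (stereographic' (n + 1) v ≫ₕ halvingChart n) (hemisphereMap n v x) = (x : 𝔼 (n + 1)) := by
  rw [OpenPartialHomeomorph.coe_trans, comp_apply, stereographic'_hemisphereMap, halvingChart_apply,
    smul_smul]
  norm_num

/-- The hemisphere map takes values in the source of the chart `σᵥ / 2`. [folklore] -/
theorem hemisphereMap_mem_source_trans (v : 𝕊 (n + 1)) (x : 𝔻 (n + 1)) :
    hemisphereMap n v x ∈ (stereographic' (n + 1) v ≫ₕ halvingChart n).source := by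
  simpa [OpenPartialHomeomorph.trans_source] using hemisphereMap_mem_source v x

/-- Reduction of Mathlib's immersion property for `hemisphereMap n v` at `x` to: a chart `e` of
the atlas of `𝔻ⁿ⁺¹` at `x` and a partial diffeomorphism `D` of `ℝⁿ⁺¹` whose inverse extends
`e⁻¹` (on `e.target`) with `x ∈ D.source`; the codomain chart is then `σᵥ / 2` followed by `D`,
in which `hemisphereMap n v` reads as the identity `ℝⁿ⁺¹ ⊇ ℍⁿ⁺¹ ∩ e.target → ℝⁿ⁺¹`. [folklore] -/
theorem isImmersionAtOfComplement_hemisphereMap_of_charts (v : 𝕊 (n + 1)) {x : 𝔻 (n + 1)}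
    (e : OpenPartialHomeomorph (𝔻 (n + 1)) (EuclideanHalfSpace (n + 1)))
    (he : e ∈ atlas (EuclideanHalfSpace (n + 1)) (𝔻 (n + 1))) (hx : x ∈ e.source)
    (D : OpenPartialHomeomorph (𝔼 (n + 1)) (𝔼 (n + 1))) (hD : ContDiffOn ℝ ∞ D D.source)
    (hD' : ContDiffOn ℝ ∞ D.symm D.target) (hxD : (x : 𝔼 (n + 1)) ∈ D.source)
    (htarget : ∀ z ∈ e.target, z.val ∈ D.target)
    (hsymm : ∀ z ∈ e.target, ((e.symm z : 𝔻 (n + 1)) : 𝔼 (n + 1)) = D.symm z.val) :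
    Manifold.IsImmersionAtOfComplement Unit (𝓡∂ (n + 1)) (𝓡 (n + 1)) ∞ (hemisphereMap n v) x := by
  refine Manifold.IsImmersionAtOfComplement.mk_of_continuousAt
    (continuous_hemisphereMap v).continuousAt (ContinuousLinearEquiv.prodUnique ℝ (𝔼 (n + 1)) Unit)
    e ((stereographic' (n + 1) v ≫ₕ halvingChart n) ≫ₕ D) hx ?_ (IsManifold.subset_maximalAtlas he)
    (trans_mem_maximalAtlas_of_contDiffOn (stereographic'_trans_halvingChart_mem_maximalAtlas v)
      D hD hD') ?_
  · rw [OpenPartialHomeomorph.trans_source, mem_inter_iff, mem_preimage,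
      stereographic'_trans_halvingChart_hemisphereMap]
    exact ⟨hemisphereMap_mem_source_trans v x, hxD⟩
  · intro z hz
    rw [OpenPartialHomeomorph.extend_target] at hz
    obtain ⟨hz, z, rfl⟩ := hz
    rw [mem_preimage, ModelWithCorners.left_inv] at hz
    simp only [comp_apply, OpenPartialHomeomorph.extend_coe, OpenPartialHomeomorph.extend_coe_symm,
      ModelWithCorners.left_inv, modelWithCornersSelf_coe, id, OpenPartialHomeomorph.trans_apply,
      stereographic'_hemisphereMap, halvingChart_apply, smul_smul]
    rw [show ((2⁻¹ : ℝ) * 2) = 1 by norm_num, one_smul, hsymm z hz, D.right_inv (htarget z hz)]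
    rfl

/-- **The hemisphere map is an immersion at interior points** `‖x‖ < 1`: domain chart the
interior chart `x ↦ x + 2e₀`, ambient factor the translation `w ↦ w + 2e₀`. [folklore] -/
theorem isImmersionAtOfComplement_hemisphereMap_of_norm_lt_one (v : 𝕊 (n + 1)) {x : 𝔻 (n + 1)}
    (hx : ‖(x : 𝔼 (n + 1))‖ < 1) :
    Manifold.IsImmersionAtOfComplement Unit (𝓡∂ (n + 1)) (𝓡 (n + 1)) ∞ (hemisphereMap n v) x := by
  set D : OpenPartialHomeomorph (𝔼 (n + 1)) (𝔼 (n + 1)) :=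
    (Homeomorph.addRight ((2 : ℝ) • closedBallBaseVector n)).toOpenPartialHomeomorph with hD
  refine isImmersionAtOfComplement_hemisphereMap_of_charts v (closedBallInteriorChart n)
    (mem_insert _ _) hx D ?_ ?_ (mem_univ _) (fun z _ => mem_univ _) fun z hz => ?_
  · exact (contDiff_id.add contDiff_const).contDiffOn
  · exact (contDiff_id.sub contDiff_const).contDiffOn
  · rw [coe_closedBallInteriorChart_symm_apply (le_of_lt hz), hD,
      Homeomorph.toOpenPartialHomeomorph_symm_apply, Homeomorph.addRight_symm,
      Homeomorph.coe_addRight, sub_eq_add_neg]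

/-- **The hemisphere map is an immersion at boundary points** `‖x‖ = 1`: domain chart the
boundary chart at `x`, ambient factor the polar chart at `x`. [folklore] -/
theorem isImmersionAtOfComplement_hemisphereMap_of_norm_eq_one (v : 𝕊 (n + 1)) {x : 𝔻 (n + 1)}
    (hx : ‖(x : 𝔼 (n + 1))‖ = 1) :
    Manifold.IsImmersionAtOfComplement Unit (𝓡∂ (n + 1)) (𝓡 (n + 1)) ∞ (hemisphereMap n v) x := by
  set p : 𝕊 n := ⟨x, mem_sphere_zero_iff_norm.2 hx⟩ with hp
  have hxe : x ∈ (closedBallBoundaryChart p).source := by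
    have := mem_chart_source (EuclideanHalfSpace (n + 1)) x
    rwa [closedBall_chartAt_of_norm_eq_one hx] at this
  refine isImmersionAtOfComplement_hemisphereMap_of_charts v (closedBallBoundaryChart p)
    (mem_insert_of_mem _ (mem_range_self p)) hxe (polarChart p) (contDiffOn_polarChart p)
    (contDiff_polarChart_symm p).contDiffOn hxe (fun z hz => hz) fun z hz =>
    coe_closedBallBoundaryChart_symm_eq_polarChart_symm p (le_of_lt hz)

/-- **The hemisphere map `𝔻ⁿ⁺¹ → 𝕊ⁿ⁺¹` is an immersion** (Mathlib's `Manifold.IsImmersion`, models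
`𝓡∂ (n + 1)` and `𝓡 (n + 1)`, complement `Unit`). [folklore] -/
theorem isImmersion_hemisphereMap (v : 𝕊 (n + 1)) :
    Manifold.IsImmersion (𝓡∂ (n + 1)) (𝓡 (n + 1)) ∞ (hemisphereMap n v) := by
  refine Manifold.IsImmersionOfComplement.isImmersion (F := Unit) fun x => ?_
  by_cases hx : ‖(x : 𝔼 (n + 1))‖ < 1
  · exact isImmersionAtOfComplement_hemisphereMap_of_norm_lt_one v hx
  · exact isImmersionAtOfComplement_hemisphereMap_of_norm_eq_one v
      ((mem_closedBall_zero_iff.1 x.2).antisymm (not_lt.1 hx))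

/-- **The hemisphere map `𝔻ⁿ⁺¹ → 𝕊ⁿ⁺¹` is a smooth embedding.** Hirsch, *Differential Topology*
(1976), §8.2, Example. [folklore] -/
theorem isSmoothEmbedding_hemisphereMap (v : 𝕊 (n + 1)) :
    Manifold.IsSmoothEmbedding (𝓡∂ (n + 1)) (𝓡 (n + 1)) ∞ (hemisphereMap n v) :=
  ⟨isImmersion_hemisphereMap v, isEmbedding_hemisphereMap v⟩

/-- The reflected hemisphere map `x ↦ ρᵥ (σᵥ⁻¹ (2x))` (onto the closed hemisphere containing `v`)
is a smooth embedding. [folklore] -/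
theorem isSmoothEmbedding_sphereReflection_comp_hemisphereMap (v : 𝕊 (n + 1)) :
    Manifold.IsSmoothEmbedding (𝓡∂ (n + 1)) (𝓡 (n + 1)) ∞
      (sphereReflection v ∘ hemisphereMap n v) :=
  (isSmoothEmbedding_hemisphereMap v).diffeomorph_comp (sphereReflection v)

end Immersion

/-! ### Discharge of `isDouble_sphere` -/

/-- The two hemisphere maps cover the sphere. [folklore] -/
theorem range_hemisphereMap_union (v : 𝕊 (n + 1)) :
    range (hemisphereMap n v) ∪ range (sphereReflection v ∘ hemisphereMap n v) = univ := by
  refine eq_univ_of_forall fun y => ?_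
  by_cases hy : ⟪(y : 𝔼 (n + 1 + 1)), (v : 𝔼 (n + 1 + 1))⟫_ℝ ≤ 0
  · exact Or.inl (mem_range_hemisphereMap hy)
  · right
    have hy' : ⟪((sphereReflection v y : 𝕊 (n + 1)) : 𝔼 (n + 1 + 1)), (v : 𝔼 (n + 1 + 1))⟫_ℝ ≤ 0 := by
      rw [inner_sphereReflection]
      linarith [not_le.1 hy]
    obtain ⟨x, hx⟩ := mem_range_hemisphereMap hy'
    exact ⟨x, by rw [comp_apply, hx, sphereReflection_sphereReflection]⟩

/-- The two hemisphere maps agree exactly along the boundary sphere: `h a = ρᵥ (h b)` iff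
`a = b ∈ 𝕊ⁿ`. [folklore] -/
theorem hemisphereMap_eq_sphereReflection_hemisphereMap_iff (v : 𝕊 (n + 1)) (a b : 𝔻 (n + 1)) :
    hemisphereMap n v a = sphereReflection v (hemisphereMap n v b) ↔
      ∃ z : 𝕊 n, a = Set.inclusion sphere_subset_closedBall z ∧
        b = Set.inclusion sphere_subset_closedBall z := by
  constructor
  · intro h
    have ha := inner_hemisphereMap_nonpos v a
    have hb := inner_hemisphereMap_nonpos v b
    have hab := congrArg (fun y : 𝕊 (n + 1) => ⟪(y : 𝔼 (n + 1 + 1)), (v : 𝔼 (n + 1 + 1))⟫_ℝ) h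
    simp only [inner_sphereReflection] at hab
    have hb0 : ⟪((hemisphereMap n v b : 𝕊 (n + 1)) : 𝔼 (n + 1 + 1)), (v : 𝔼 (n + 1 + 1))⟫_ℝ = 0 := by
      linarith
    have ha1 : ‖(a : 𝔼 (n + 1))‖ = 1 := (inner_hemisphereMap_eq_zero_iff v a).1 (by linarith)
    rw [(sphereReflection_eq_self_iff v _).2 hb0] at h
    have hab' : a = b := injective_hemisphereMap v h
    exact ⟨⟨a, mem_sphere_zero_iff_norm.2 ha1⟩, Subtype.ext rfl, Subtype.ext (by rw [← hab'])⟩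
  · rintro ⟨z, rfl, rfl⟩
    rw [eq_comm, sphereReflection_eq_self_iff, inner_hemisphereMap_eq_zero_iff]
    exact norm_eq_of_mem_sphere z

variable (n) in
/-- A concrete pole of `𝕊ⁿ⁺¹`: the basis vector `e₀`. [folklore] -/
def spherePole : 𝕊 (n + 1) := ⟨EuclideanSpace.single 0 1, by simp⟩

/-- **Discharge of the named fact `isDouble_sphere`**: `𝕊ⁿ⁺¹` is the double of `𝔻ⁿ⁺¹`, i.e. a
gluing of two copies of `𝔻ⁿ⁺¹` along the identity of `∂𝔻ⁿ⁺¹ = 𝕊ⁿ` in the sense of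
`Literature.Topology.FourManifolds.IsDouble` / `Literature.Topology.FourManifolds.IsClosedGluing` (`Gluing.lean`). Real proof: the two smooth embeddings are
the hemisphere map `x ↦ σ⁻¹ (2x)` (inverse stereographic projection from the pole `e₀`, onto the
closed hemisphere `{y | y 0 ≤ 0}`) and its reflection in the equatorial hyperplane (onto
`{y | 0 ≤ y 0}`); they cover `𝕊ⁿ⁺¹` and meet exactly along the equator, where both restrict to
the same embedding of `𝕊ⁿ`. Hirsch, *Differential Topology* (1976), §8.2, Example; Bröcker–Jänich
(1982), §13; Kosinski (1993), VI.5. [cite: Hirsch1976, §8.2 Example] -/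
theorem isDouble_sphere_holds [Fact (isSmoothEmbedding_sphereInclusion' n)] : isDouble_sphere n :=
  ⟨hemisphereMap n (spherePole n), sphereReflection (spherePole n) ∘ hemisphereMap n (spherePole n),
    isSmoothEmbedding_hemisphereMap _, isSmoothEmbedding_sphereReflection_comp_hemisphereMap _,
    range_hemisphereMap_union _,
    fun a b => hemisphereMap_eq_sphereReflection_hemisphereMap_iff _ a b⟩

end Literature.Topology.FourManifolds

end
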